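import Summits.Ventures.LatticeQCDFlow.Scaling.HomStarPathLumping
import Summits.Ventures.LatticeQCDFlow.Scaling.LumpedStarStepSampleSize
import Literature.Probability.MarkovChains.GroupInverse

/-!
HONEST FRAMING: exact (Metropolis-corrected) sampling algorithms for lattice gauge theory; figures
of merit are autocorrelation/cost numbers at stated couplings and volumes; no continuum-physics
claim.

# HomStarStationaryLumping — THE LUMPED STATIONARY LAW IS THE SCHEME'S OWN EQUILIBRIUM PUSHED FORWARD: `π_S = Λ_*(μ_0 ⊗ μ_1 ⊗ ⋯ ⊗ μ_1)` (lean-2 GEN-44, ours)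

Venture-side (OURS).  Cell `lqcd-flow` (pub-lqcd), unit `pub-lqcd-lean-2-g44`, 2026-08-31.  Chapter AD, file 15 — the identification named
open in files 9–14: those files measure the pooled law of chapter U's homogeneous replica-exchange star against the lumped star's stationary law
`π_S(x) ∝ g(comp x)·comp x(hub x)/W(hub x)` of chapter X; here `π_S` is shown to BE the push-forward through `Λ = (hub content, composition)`
of the scheme's own equilibrium, the product law `μ_0 ⊗ μ_1 ⊗ ⋯ ⊗ μ_1` (`tensorFun μ`).  The proof is structural, with no multinomial
bookkeeping: (1) the scheme kernel `P = t·ptGraphSwap + (1−t)·prodKernel w M` is in detailed balance with `tensorFun μ` (chapter T's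
`ptGraphSwap_detailedBalance` and LPW §12.4 `prodKernel_detailedBalance`, the hot coordinate redrawn from `μ_0`, the cold ones idle), hence
`tensorFun μ` is stationary; (2) by the one-step intertwining of file 9 (`Λ_*(νP) = (Λ_*ν)S_l`) its push-forward is stationary for the lazy
lumped kernel `S_l`; (3) `π_S` is stationary for `S_l` too (chapter X's detailed balance, file 13's lazy toolkit) and `S_l` is irreducible
(chapter X file 7 + file 13), so the two agree by the UNIQUENESS of the stationary distribution of an irreducible chain (the tree's
`IsStationary.eq_of_isIrreducible`, [KirklandNeumann2012, §5.1] typed in `Literature/Probability/MarkovChains/GroupInverse`).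

* `homStar_tensor_detailedBalance` — `tensorFun μ` is in detailed balance with the scheme kernel.
* `homStar_tensor_rowsum` — the scheme kernel has unit row sums.
* `homStar_pushforward_isStationary` — `Λ_*(tensorFun μ)` is stationary for `S_l`.
* **`homStar_piS_eq_pushforward`** — `π_S(x) = Σ_{y : Λy = x} (tensorFun μ)(y)` for every lumped state `x`.
* `pushforward_sum_mul`, **`homStar_lawMean_lawVariance_eq`** — `E_{π_S} f = E_{⊗μ}[f∘Λ]`, `Var_{π_S} f = Var_{⊗μ}[f∘Λ]`: the stationary statistics of files 5∕14 are the
  scheme's own equilibrium statistics of the pooled estimator.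

Reading (no numerics implied): files 9–14 are therefore statements about the distance of the scheme's pooled law from the push-forward of
the scheme's OWN equilibrium, i.e. honest equilibration statements for pooled estimators.  Literature grade (cell rule): OWN COMPOSITION on
typed tree facts ([LevinPeres2017, §12.4]; [KirklandNeumann2012, §5.1]); nothing new cited; no new bib keys.
-/

noncomputable section
open Finset Function
open Literature.Probability.MarkovChains

namespace Summit.Ventures.LatticeQCDFlow.Scaling

section StationaryLumping
variable {S : Type*} [Fintype S] [DecidableEq S] {K m : ℕ} {μ : Fin (K + 1) → S → ℝ} {M : Fin (K + 1) → S → S → ℝ} {w : Fin (K + 1) → ℝ} {t : ℝ}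
variable (κ : Fin m → Fin K)
variable {X : Type*} [Fintype X] [DecidableEq X] {hub : X → S} {comp : X → S → ℕ} {W : S → ℝ} {acc : S → S → ℝ} {Kh : (S → ℕ) → S → S → ℝ}
variable {Ast Bst Sl : X → X → ℝ} {g : (S → ℕ) → ℝ} {πS : X → ℝ} {Z : ℝ}
variable {Λ : (Fin (K + 1) → S) → X}

omit κ in
/-- The product law `μ_0 ⊗ ⋯ ⊗ μ_K` is in detailed balance with the scheme kernel `t·ptGraphSwap + (1−t)·prodKernel w M` when the
hot coordinate is redrawn from `μ_0` and the cold ones are idle. [ours] -/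
theorem homStar_tensor_detailedBalance (hμ : ∀ k x, 0 < μ k x) (hM0 : ∀ u v, M 0 u v = μ 0 v)
    (hidle : ∀ i : Fin K, ∀ u v, M i.succ u v = if v = u then 1 else 0)
    (e : Fin m → Fin (K + 1) × Fin (K + 1)) (φ : Fin m → Equiv.Perm S) :
    DetailedBalance (tensorFun μ) (fun y z => t * ptGraphSwap μ e φ y z + (1 - t) * prodKernel w M y z) := by
  classical
  have hM : ∀ j, DetailedBalance (μ j) (M j) := by
    intro j
    refine Fin.cases ?_ (fun i => ?_) j
    · intro u v; rw [hM0, hM0]; ring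
    · intro u v
      rw [hidle, hidle]
      by_cases h : v = u
      · subst h; rfl
      · rw [if_neg h, if_neg (Ne.symm h), mul_zero, mul_zero]
  have h1 := ptGraphSwap_detailedBalance (e := e) (φ := φ) hμ
  have h2 := prodKernel_detailedBalance hM w
  intro y z
  calc tensorFun μ y * (t * ptGraphSwap μ e φ y z + (1 - t) * prodKernel w M y z)
      = t * (tensorFun μ y * ptGraphSwap μ e φ y z) + (1 - t) * (tensorFun μ y * prodKernel w M y z) := by ring
    _ = t * (tensorFun μ z * ptGraphSwap μ e φ z y) + (1 - t) * (tensorFun μ z * prodKernel w M z y) := by rw [h1 y z, h2 y z]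
    _ = tensorFun μ z * (t * ptGraphSwap μ e φ z y + (1 - t) * prodKernel w M z y) := by ring

omit κ in
/-- The scheme kernel has unit row sums. [ours] -/
theorem homStar_tensor_rowsum (hμ : ∀ k x, 0 < μ k x) (hμsum : ∀ k, ∑ u, μ k u = 1) (hw0 : ∀ k, 0 ≤ w k) (hw1 : ∑ k, w k = 1)
    (hM0 : ∀ u v, M 0 u v = μ 0 v) (hidle : ∀ i : Fin K, ∀ u v, M i.succ u v = if v = u then 1 else 0)
    (e : Fin m → Fin (K + 1) × Fin (K + 1)) (φ : Fin m → Equiv.Perm S) (y : Fin (K + 1) → S) :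
    ∑ z, (t * ptGraphSwap μ e φ y z + (1 - t) * prodKernel w M y z) = 1 := by
  classical
  have hMrs : ∀ j, IsRowStochastic (M j) := by
    intro j
    refine Fin.cases ?_ (fun i => ?_) j
    · exact ⟨fun u v => by rw [hM0]; exact (hμ 0 v).le, fun u => by simp_rw [hM0]; exact hμsum 0⟩
    · refine ⟨fun u v => by rw [hidle]; split_ifs <;> norm_num, fun u => ?_⟩
      simp_rw [hidle]
      rw [Finset.sum_ite_eq' univ u, if_pos (mem_univ _)]
  have hSW := (ptGraphSwap_isRowStochastic (e := e) (φ := φ) hμ).2 y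
  have hPK := (prodKernel_isRowStochastic M w hw0 hw1 hMrs).2 y
  rw [sum_add_distrib, ← mul_sum, ← mul_sum, hSW, hPK]; ring

/-- **The push-forward of the product law is stationary for the lazy lumped kernel** `S_l = t·A + (1−t)(w_0·B + (1−w_0)𝟙)`, by the
one-step intertwining of file 9. [ours] -/
theorem homStar_pushforward_isStationary (hm : 1 ≤ m) (hμ : ∀ k x, 0 < μ k x) (hμsum : ∀ k, ∑ u, μ k u = 1)
    (hhom : ∀ i : Fin K, μ i.succ = μ 1) (hw0 : ∀ k, 0 ≤ w k) (hw1 : ∑ k, w k = 1)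
    (hM0 : ∀ u v, M 0 u v = μ 0 v) (hidle : ∀ i : Fin K, ∀ u v, M i.succ u v = if v = u then 1 else 0)
    {c : ℕ} (hunif : ∀ i : Fin K, (univ.filter fun r : Fin m => κ r = i).card = c)
    (hacc : ∀ u v, acc u v = min 1 (μ 0 v * μ 1 u / (μ 0 u * μ 1 v)))
    (hKoff : ∀ N h v, h ≠ v → Kh N h v = if N h = 0 then 0 else (N v : ℝ) / K * acc h v) (hKdiag : ∀ N h, Kh N h h = 1 - ∑ v ∈ univ.erase h, Kh N h v)
    (hA : ∀ x x', Ast x x' = if comp x' = comp x then Kh (comp x) (hub x) (hub x') else 0)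
    (hB : ∀ x x', Bst x x' = μ 0 (hub x') * (if comp x' + Pi.single (hub x) 1 = comp x + Pi.single (hub x') 1 then 1 else 0))
    (hSl : ∀ x x', Sl x x' = t * Ast x x' + (1 - t) * (w 0 * Bst x x' + (1 - w 0) * (if x = x' then 1 else 0)))
    (hΛh : ∀ y, hub (Λ y) = y 0) (hΛc : ∀ y v, comp (Λ y) v = (univ.filter fun k : Fin (K + 1) => y k = v).card)
    (hinj : ∀ x x', hub x = hub x' → comp x = comp x' → x = x') :
    IsStationary (fun x => ∑ y ∈ univ.filter (fun y => Λ y = x), tensorFun μ y) Sl := by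
  classical
  intro x'
  have hstat : stepLaw (fun y z => t * ptGraphSwap μ (fun r : Fin m => (((0 : Fin (K + 1)), (κ r).succ) : Fin (K + 1) × Fin (K + 1))) (fun _ : Fin m => Equiv.refl S) y z
      + (1 - t) * prodKernel w M y z) (tensorFun μ) = tensorFun μ := by
    funext z
    exact (homStar_tensor_detailedBalance hμ hM0 hidle _ _).isStationary
      (homStar_tensor_rowsum hμ hμsum hw0 hw1 hM0 hidle _ _) z
  have h := homStar_pushforward_step κ hm hμ hhom hw1 hM0 hidle hunif hacc hKoff hKdiag hA hB hSl hΛh hΛc hinj (tensorFun μ) x'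
  rw [hstat] at h
  have h' := h.symm
  simp only [stepLaw] at h'
  exact h'

/-- **`π_S = Λ_*(μ_0 ⊗ μ_1 ⊗ ⋯ ⊗ μ_1)`: the lumped star's stationary law is the push-forward of the scheme's product equilibrium**
(uniqueness of the stationary distribution of the irreducible lazy lumped chain). [ours] -/
theorem homStar_piS_eq_pushforward [Nonempty X] (hm : 1 ≤ m) (hμ : ∀ k x, 0 < μ k x) (hμsum : ∀ k, ∑ u, μ k u = 1)
    (hhom : ∀ i : Fin K, μ i.succ = μ 1) (hw0 : ∀ k, 0 ≤ w k) (hw00 : 0 < w 0) (hw1 : ∑ k, w k = 1) (ht0 : 0 < t) (ht1 : t < 1)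
    (hM0 : ∀ u v, M 0 u v = μ 0 v) (hidle : ∀ i : Fin K, ∀ u v, M i.succ u v = if v = u then 1 else 0)
    {c : ℕ} (hunif : ∀ i : Fin K, (univ.filter fun r : Fin m => κ r = i).card = c)
    (hWdef : ∀ v, W v = μ 1 v / μ 0 v) (hinj : ∀ x x', hub x = hub x' → comp x = comp x' → x = x') (hsum : ∀ x, ∑ v, comp x v = K + 1)
    (hsurj : ∀ (z : S) (N : S → ℕ), ∑ v, N v = K + 1 → N z ≠ 0 → ∃ x, hub x = z ∧ comp x = N) (hhub : ∀ x, comp x (hub x) ≠ 0) (hK : 1 ≤ K)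
    (hacc : ∀ h v, acc h v = min 1 (W h / W v))
    (hKoff : ∀ N h v, h ≠ v → Kh N h v = if N h = 0 then 0 else (N v : ℝ) / K * acc h v) (hKdiag : ∀ N h, Kh N h h = 1 - ∑ v ∈ univ.erase h, Kh N h v)
    (hA : ∀ x x', Ast x x' = if comp x' = comp x then Kh (comp x) (hub x) (hub x') else 0)
    (hB : ∀ x x', Bst x x' = μ 0 (hub x') * (if comp x' + Pi.single (hub x) 1 = comp x + Pi.single (hub x') 1 then 1 else 0))
    (hSl : ∀ x x', Sl x x' = t * Ast x x' + (1 - t) * (w 0 * Bst x x' + (1 - w 0) * (if x = x' then 1 else 0)))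
    (hg : ∀ N, g N = ∏ v, (μ 0 v * W v) ^ (N v) / ((N v).factorial : ℝ))
    (hZ : Z = ∑ x, g (comp x) * ((comp x (hub x) : ℝ) / W (hub x))) (hπS : ∀ x, πS x = g (comp x) * ((comp x (hub x) : ℝ) / W (hub x)) / Z)
    (hΛh : ∀ y, hub (Λ y) = y 0) (hΛc : ∀ y v, comp (Λ y) v = (univ.filter fun k : Fin (K + 1) => y k = v).card) (x : X) :
    πS x = ∑ y ∈ univ.filter (fun y => Λ y = x), tensorFun μ y := by
  classical
  -- scalars and the `W`-free acceptance
  have hW : ∀ v, 0 < W v := fun v => by rw [hWdef]; exact div_pos (hμ 1 v) (hμ 0 v)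
  have hh0 : 0 < (1 - t) * w 0 := mul_pos (by linarith) hw00
  have hq0 : 0 < t + (1 - t) * w 0 := by linarith
  have hw01 : w 0 ≤ 1 := by
    calc w 0 ≤ ∑ k, w k := single_le_sum (fun k _ => hw0 k) (mem_univ 0)
      _ = 1 := hw1
  have hq1 : t + (1 - t) * w 0 ≤ 1 := by nlinarith [hw0 0]
  obtain ⟨σ, hσ⟩ : ∃ s : ℝ, s = t / (t + (1 - t) * w 0) := ⟨_, rfl⟩
  have hσ0 : 0 < σ := by rw [hσ]; exact div_pos ht0 hq0
  have hσ1 : σ < 1 := by rw [hσ, div_lt_one hq0]; linarith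
  have hacc' : ∀ u v, acc u v = min 1 (μ 0 v * μ 1 u / (μ 0 u * μ 1 v)) := by
    intro u v
    rw [hacc, hWdef, hWdef]
    congr 1
    have h1 := hμ 0 u; have h2 := hμ 0 v; have h3 := hμ 1 u; have h4 := hμ 1 v
    field_simp
  -- the step chain `S_σ` and the lazy lumped chain `S_l = q S_σ + (1−q) I`, `q = t + (1−t) w_0`
  obtain ⟨Sst, hS⟩ : ∃ S' : X → X → ℝ, ∀ x x', S' x x' = σ * Ast x x' + (1 - σ) * Bst x x' := ⟨_, fun _ _ => rfl⟩
  have hSl' : ∀ x x', Sl x x' = (t + (1 - t) * w 0) * Sst x x' + (1 - (t + (1 - t) * w 0)) * (if x = x' then 1 else 0) := by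
    intro x x'; rw [hSl, hS, hσ]; have hq' : (t + (1 - t) * w 0) ≠ 0 := hq0.ne'; field_simp; ring
  have hπ := lumpedStar_piS_pos hhub hW (hμ 0) hg hZ hπS
  have hπ1 := lumpedStar_piS_sum hhub hW (hμ 0) hg hZ hπS
  have hA0 : ∀ x x', 0 ≤ Ast x x' := starStep_swap_nonneg hW hacc hK hsum hKoff hKdiag hA
  have hA1 : ∀ x, ∑ x', Ast x x' = 1 := starStep_swap_rowsum hinj hsurj hhub hsum hKoff hKdiag hA
  have hArev : ∀ x x', πS x * Ast x x' = πS x' * Ast x' x := starStep_swap_reversible hinj hhub hW hacc hKoff hA hπS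
  have hB0 : ∀ x x', 0 ≤ Bst x x' := fun x x' => by rw [hB]; exact mul_nonneg (hμ 0 _).le (by split_ifs <;> norm_num)
  have hB1 : ∀ x, ∑ x', Bst x x' = 1 := starStep_redraw_rowsum hinj hsurj hhub hsum (hμsum 0) hB
  have hBrev : ∀ x x', πS x * Bst x x' = πS x' * Bst x' x := starStep_redraw_reversible hhub hW hg hπS hB
  have hSrs : IsRowStochastic Sst := stepChain_rowStochastic hA0 hA1 hB0 hB1 hσ0.le hσ1 hS
  have hDB : DetailedBalance πS Sst := stepChain_detailedBalance hArev hBrev hS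
  have hirr := lumpedStar_step_irreducible hsurj hhub hW hacc hK hsum hKoff hKdiag (hμ 0) hσ0 hσ1 hA hB hS
  have hSlrs : IsRowStochastic Sl := lazyq_isRowStochastic (S := Sst) hSrs hq0.le hq1 hSl'
  have hSlDB : DetailedBalance πS Sl := lazyq_detailedBalance (S := Sst) hDB hSl'
  have hSlirr : Literature.Probability.MarkovChains.IsIrreducible Sl := lazyq_isIrreducible (S := Sst) hSrs.1 hq0 hq1 hSl' hirr
  -- both laws are stationary probability vectors of the irreducible `S_l`
  have hst : IsStationary πS Sl := hSlDB.isStationary hSlrs.2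
  have hst' := homStar_pushforward_isStationary κ hm hμ hμsum hhom hw0 hw1 hM0 hidle hunif hacc' hKoff hKdiag hA hB hSl hΛh hΛc hinj
  have hsum' : ∑ x, ∑ y ∈ univ.filter (fun y => Λ y = x), tensorFun μ y = 1 := by
    rw [Finset.sum_fiberwise univ Λ (fun y => tensorFun μ y)]
    exact sum_tensorFun_eq_one μ hμsum
  have heq := IsStationary.eq_of_isIrreducible hSlrs hπ1 hst hSlirr hsum' hst'
  exact (congrFun heq x).symm


omit [DecidableEq S] in
omit κ in
/-- Fibrewise summation: a law on configurations integrates a pulled-back observable as its push-forward integrates the observable. [ours] -/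
theorem pushforward_sum_mul (ν : (Fin (K + 1) → S) → ℝ) (f : X → ℝ) :
    ∑ y, ν y * f (Λ y) = ∑ x, (∑ y ∈ univ.filter (fun y => Λ y = x), ν y) * f x := by
  classical
  rw [← Finset.sum_fiberwise univ Λ (fun y => ν y * f (Λ y))]
  refine sum_congr rfl fun x _ => ?_
  rw [sum_mul]
  exact sum_congr rfl fun y hy => by rw [(mem_filter.mp hy).2]

/-- **The stationary mean and variance of a pooled observable are the scheme's own equilibrium mean and variance of its pull-back:**
`E_{π_S} f = E_{μ_0⊗μ_1⊗⋯⊗μ_1}[f ∘ Λ]` and `Var_{π_S} f = Var_{μ_0⊗μ_1⊗⋯⊗μ_1}[f ∘ Λ]` — so the `lawMean π_S`, `lawVariance π_S` of files 5 and 14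
are the equilibrium statistics of the pooled estimator under the ACTUAL scheme. [ours] -/
theorem homStar_lawMean_lawVariance_eq [Nonempty X] (hm : 1 ≤ m) (hμ : ∀ k x, 0 < μ k x) (hμsum : ∀ k, ∑ u, μ k u = 1)
    (hhom : ∀ i : Fin K, μ i.succ = μ 1) (hw0 : ∀ k, 0 ≤ w k) (hw00 : 0 < w 0) (hw1 : ∑ k, w k = 1) (ht0 : 0 < t) (ht1 : t < 1)
    (hM0 : ∀ u v, M 0 u v = μ 0 v) (hidle : ∀ i : Fin K, ∀ u v, M i.succ u v = if v = u then 1 else 0)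
    {c : ℕ} (hunif : ∀ i : Fin K, (univ.filter fun r : Fin m => κ r = i).card = c)
    (hWdef : ∀ v, W v = μ 1 v / μ 0 v) (hinj : ∀ x x', hub x = hub x' → comp x = comp x' → x = x') (hsum : ∀ x, ∑ v, comp x v = K + 1)
    (hsurj : ∀ (z : S) (N : S → ℕ), ∑ v, N v = K + 1 → N z ≠ 0 → ∃ x, hub x = z ∧ comp x = N) (hhub : ∀ x, comp x (hub x) ≠ 0) (hK : 1 ≤ K)
    (hacc : ∀ h v, acc h v = min 1 (W h / W v))
    (hKoff : ∀ N h v, h ≠ v → Kh N h v = if N h = 0 then 0 else (N v : ℝ) / K * acc h v) (hKdiag : ∀ N h, Kh N h h = 1 - ∑ v ∈ univ.erase h, Kh N h v)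
    (hA : ∀ x x', Ast x x' = if comp x' = comp x then Kh (comp x) (hub x) (hub x') else 0)
    (hB : ∀ x x', Bst x x' = μ 0 (hub x') * (if comp x' + Pi.single (hub x) 1 = comp x + Pi.single (hub x') 1 then 1 else 0))
    (hSl : ∀ x x', Sl x x' = t * Ast x x' + (1 - t) * (w 0 * Bst x x' + (1 - w 0) * (if x = x' then 1 else 0)))
    (hg : ∀ N, g N = ∏ v, (μ 0 v * W v) ^ (N v) / ((N v).factorial : ℝ))
    (hZ : Z = ∑ x, g (comp x) * ((comp x (hub x) : ℝ) / W (hub x))) (hπS : ∀ x, πS x = g (comp x) * ((comp x (hub x) : ℝ) / W (hub x)) / Z)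
    (hΛh : ∀ y, hub (Λ y) = y 0) (hΛc : ∀ y v, comp (Λ y) v = (univ.filter fun k : Fin (K + 1) => y k = v).card) (f : X → ℝ) :
    lawMean πS f = lawMean (tensorFun μ) (fun y => f (Λ y))
      ∧ lawVariance πS f = lawVariance (tensorFun μ) (fun y => f (Λ y)) := by
  classical
  have hπ : ∀ x, πS x = ∑ y ∈ univ.filter (fun y => Λ y = x), tensorFun μ y := fun x =>
    homStar_piS_eq_pushforward κ hm hμ hμsum hhom hw0 hw00 hw1 ht0 ht1 hM0 hidle hunif hWdef hinj hsum hsurj hhub hK hacc hKoff hKdiag hA hB hSl hg hZ hπS hΛh hΛc x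
  have hmean : lawMean πS f = lawMean (tensorFun μ) (fun y => f (Λ y)) := by
    simp only [lawMean]
    rw [pushforward_sum_mul (tensorFun μ) f]
    exact sum_congr rfl fun x _ => by rw [hπ x]
  refine ⟨hmean, ?_⟩
  simp only [lawVariance]
  rw [← hmean, pushforward_sum_mul (tensorFun μ) (fun x => (f x - lawMean πS f) ^ 2)]
  exact sum_congr rfl fun x _ => by rw [hπ x]

end StationaryLumping

end Summit.Ventures.LatticeQCDFlow.Scaling

end
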